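import Mathlib
import Summits.FinalStateConjecture.FinalStateConjecture.Statement

/-!
# SoloInformed — the summit's exceptional set is a union, and comb genericity is not closed under unions

Soloist `solo-FinalStateConjecture-informed`, session 2 (2026-08-18). Kernel facts about the
QUANTIFIER SHAPE of the summit `FinalStateConjecture`; no geometry is used.

1. `exceptional_eq_union`, `finalStateConjecture_iff_union`: the summit is, verbatim, the statement
   that for every `Σ` the union `𝓔_W ∪ 𝓔_S` of the CENSORSHIP-exceptional set (no MGHD, or an MGHD
   with incomplete `𝓘⁺`) and the SETTLING-exceptional set (no MGHD, or an MGHD whose exterior does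
   not settle to sub-extremal Kerr black holes in the typed sense) has tame Christodoulou
   codimension `≥ 1` in the admissible class (`InitialDataSet.HasTameCodimAtLeastIn`,
   `Literature/Geometry/Lorentzian/TameGenericity.lean`).
2. A finite-dimensional model of that quantifier — `escapable 𝓓 E`, the set of points through which
   passes a smooth, immersed (`deriv γ 0 ≠ 0`), injective curve of admissible data meeting `E` only
   at the parameter `0`; "`E` has comb codimension one in `𝓓`" is `E ⊆ escapable 𝓓 E`, the shape of
   `HasTameCodimAtLeastIn 𝓓 E 1` under the dictionary: jointly smooth family ↦ `ContDiff ℝ ∞ γ`,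
   `IsImmersedAtZero` ↦ `deriv γ 0 ≠ 0`, tame on the fixed end (weighted continuity at `c = 0`,
   continuous mass) ↦ automatic in finite dimension, the clauses `∀ c, F c ∈ 𝓓`, `∀ c ≠ 0, F c ∉ 𝓔`
   verbatim — in which, in `ℝ × ℝ`:
   * the limit sheet `L = {y = 0}` and the comb `C = ⋃ₙ {|y| = 1/(n+1)}` EACH have comb
     codimension one (`limitSheet_subset_escapable`, `combSheets_subset_escapable`; the escaping
     curves through `C` must be bounded reparametrisations of vertical segments, since a straight
     line meets the other sheets at parameters `c ≠ 0` — the clause is global in `c`);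
   * through every point of `L`, EVERY continuous curve meets `L ∪ C` again at some `c ≠ 0`
     (`exists_ne_zero_mem_union_of_continuous`, intermediate value theorem on `|y|`), so `L ∪ C`
     does NOT have comb codimension one in any class (`not_union_subset_escapable`), although it is
     closed and Lebesgue-null (`isClosed_union`, `volume_union_eq_zero`);
   * hence comb codimension one is not preserved by unions (`not_forall_union_subset_escapable`).

Consequences for the summit. (G1) Tame genericity is a condition on the LOCAL structure of the
exceptional set at EACH of its points; smallness of `𝓔` in measure or category is no evidence for
it (nested exceptional "thresholds" accumulating on an exceptional datum defeat it). (G2) By 1. and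
the model, the summit does not follow by logic from "tame-generic weak cosmic censorship" and
"tame-generic settling" (each `HasTameCodimAtLeastIn 𝓓 𝓔_W 1`, `HasTameCodimAtLeastIn 𝓓 𝓔_S 1`): a
proof must produce ONE escaping family per exceptional datum serving both conclusions, i.e. control
the union `𝓔_W ∪ 𝓔_S` pointwise. (The sound direction, monotonicity in the property, is
`isTameChristodoulouGeneric_mono` in `SoloInformedNecessaryWCC.lean`.)

References: Christodoulou, CQG 16 (1999) A23, p. A24 [Christodoulou1999]; Ann. Math. 149 (1999) 183,
Thm. p. 187; Dafermos–Luk arXiv:1710.01722 §1.2.1 [DafermosLuk2017].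
-/

noncomputable section

set_option linter.dupNamespace false

open Set Filter Topology MeasureTheory Literature.Geometry.Lorentzian
open scoped ContDiff Manifold

namespace Summit.FinalStateConjecture.FinalStateConjecture.Theorems

/-! ### 1. The summit's exceptional set is the union of two exceptional sets -/

section Summit

variable (X : Type) [TopologicalSpace X] [ChartedSpace E3 X] [IsManifold (𝓡 3) ∞ X] [T2Space X]
  [SecondCountableTopology X] [ConnectedSpace X]

/-- The **censorship-exceptional set** `𝓔_W(Σ)`: admissible vacuum data with no maximal vacuum Cauchy
development, or with one whose future null infinity is incomplete (sojourn form). Its tame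
codimension `≥ 1` is weak cosmic censorship in the summit's typing. [cite: Christodoulou1999, p. A27] -/
def censorshipExceptional : Set (InitialDataSet (𝓡 3) X) :=
  {D ∈ admissibleVacuumData X | ¬ ((∃ 𝒟 : VacuumCauchyDevelopment D, 𝒟.IsMaximal) ∧
    ∀ 𝒟 : VacuumCauchyDevelopment D, 𝒟.IsMaximal →
      Summit.FinalStateConjecture.HasCompleteNullInfinity 𝒟.toCauchyDevelopment)}

/-- The **settling-exceptional set** `𝓔_S(Σ)`: admissible vacuum data with no maximal vacuum Cauchy
development, or with one whose exterior does not settle, in the typed `C²` sense, to finitely many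
sub-extremal boosted Kerr black holes plus a flat radiation zone. [cite: DafermosLuk2017, §1.2.1] -/
def settlingExceptional : Set (InitialDataSet (𝓡 3) X) :=
  {D ∈ admissibleVacuumData X | ¬ ((∃ 𝒟 : VacuumCauchyDevelopment D, 𝒟.IsMaximal) ∧
    ∀ 𝒟 : VacuumCauchyDevelopment D, 𝒟.IsMaximal →
      ∃ (O : Set 𝒟.carrier) (d : FinalStateDecomposition 𝒟.toSpacetime O 2),
        (∀ i, Kerr.IsSubextremal (d.mass i) (d.spin i)) ∧
          O = Summit.FinalStateConjecture.exteriorOf 𝒟.toCauchyDevelopment d.charted ∧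
            Summit.FinalStateConjecture.RaysStayInClosure 𝒟.toCauchyDevelopment O ∧
              Summit.FinalStateConjecture.HasExhaustiveCharts d ∧
                Summit.FinalStateConjecture.IsFutureOriented d)}

omit [T2Space X] [SecondCountableTopology X] in
/-- The exceptional set of the summit's pointwise property is `𝓔_W ∪ 𝓔_S` (pure logic). [folklore] -/
theorem exceptional_eq_union :
    {D ∈ admissibleVacuumData X | ¬ ((∃ 𝒟 : VacuumCauchyDevelopment D, 𝒟.IsMaximal) ∧
        ∀ 𝒟 : VacuumCauchyDevelopment D, 𝒟.IsMaximal →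
          Summit.FinalStateConjecture.HasCompleteNullInfinity 𝒟.toCauchyDevelopment ∧
            ∃ (O : Set 𝒟.carrier) (d : FinalStateDecomposition 𝒟.toSpacetime O 2),
              (∀ i, Kerr.IsSubextremal (d.mass i) (d.spin i)) ∧
                O = Summit.FinalStateConjecture.exteriorOf 𝒟.toCauchyDevelopment d.charted ∧
                  Summit.FinalStateConjecture.RaysStayInClosure 𝒟.toCauchyDevelopment O ∧
                    Summit.FinalStateConjecture.HasExhaustiveCharts d ∧
                      Summit.FinalStateConjecture.IsFutureOriented d)} =
      censorshipExceptional X ∪ settlingExceptional X := by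
  ext D
  constructor
  · rintro ⟨hD, hn⟩
    by_cases hW : (∃ 𝒟 : VacuumCauchyDevelopment D, 𝒟.IsMaximal) ∧
        ∀ 𝒟 : VacuumCauchyDevelopment D, 𝒟.IsMaximal →
          Summit.FinalStateConjecture.HasCompleteNullInfinity 𝒟.toCauchyDevelopment
    · exact Or.inr ⟨hD, fun hS ↦ hn ⟨hS.1, fun 𝒟 h𝒟 ↦ ⟨hW.2 𝒟 h𝒟, hS.2 𝒟 h𝒟⟩⟩⟩
    · exact Or.inl ⟨hD, hW⟩
  · rintro (⟨hD, hW⟩ | ⟨hD, hS⟩)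
    · exact ⟨hD, fun hP ↦ hW ⟨hP.1, fun 𝒟 h𝒟 ↦ (hP.2 𝒟 h𝒟).1⟩⟩
    · exact ⟨hD, fun hP ↦ hS ⟨hP.1, fun 𝒟 h𝒟 ↦ (hP.2 𝒟 h𝒟).2⟩⟩

end Summit

/-- **The final state conjecture, union form**: for every `Σ`, the union of the censorship- and the
settling-exceptional sets has tame codimension `≥ 1` in the admissible class. This is the summit
verbatim (`Iff` by unfolding `IsTameChristodoulouGeneric` and `exceptional_eq_union`); it displays the
statement as ONE pointwise-local condition on `𝓔_W ∪ 𝓔_S`, which (by the model below) is not the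
conjunction of the two conditions on `𝓔_W` and on `𝓔_S`. [cite: DafermosLuk2017, §1.2.1] -/
theorem finalStateConjecture_iff_union :
    FinalStateConjecture ↔
      ∀ (X : Type) [TopologicalSpace X] [ChartedSpace E3 X] [IsManifold (𝓡 3) ∞ X] [T2Space X]
        [SecondCountableTopology X] [ConnectedSpace X],
        InitialDataSet.HasTameCodimAtLeastIn (admissibleVacuumData X)
          (censorshipExceptional X ∪ settlingExceptional X) 1 := by
  constructor
  · intro h X _ _ _ _ _ _
    rw [← exceptional_eq_union X]
    exact h X
  · intro h X _ _ _ _ _ _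
    have h' := h X
    rw [← exceptional_eq_union X] at h'
    exact h'

/-! ### 2. The finite-dimensional model -/

/-- **Escapable points.** For an admissible class `𝓓` and an exceptional set `E` in a real normed
space `V`, `escapable 𝓓 E` is the set of points `p` through which passes a smooth curve `γ : ℝ → V`,
immersed at `0` (`deriv γ 0 ≠ 0`), injective, with `γ 0 = p`, all of whose members lie in `𝓓` and
which meets `E` only at the parameter `0`. "`E` has comb codimension one in `𝓓`" is
`E ⊆ escapable 𝓓 E` — the quantifier shape of `InitialDataSet.HasTameCodimAtLeastIn 𝓓 E 1`.
[cite: Christodoulou1999, p. A24] -/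
def escapable {V : Type*} [NormedAddCommGroup V] [NormedSpace ℝ V] (𝓓 E : Set V) : Set V :=
  {p | ∃ γ : ℝ → V, ContDiff ℝ ∞ γ ∧ deriv γ 0 ≠ 0 ∧ γ 0 = p ∧ Function.Injective γ ∧
    (∀ c, γ c ∈ 𝓓) ∧ ∀ c ≠ 0, γ c ∉ E}

/-- The **limit sheet** `L = {y = 0} ⊂ ℝ²`. [folklore] -/
def limitSheet : Set (ℝ × ℝ) := {p | p.2 = 0}

/-- The **comb** `C = ⋃ₙ {|y| = 1/(n+1)} ⊂ ℝ²`: sheets accumulating on the limit sheet from both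
sides. [folklore] -/
def combSheets : Set (ℝ × ℝ) := {p | ∃ n : ℕ, |p.2| = 1 / ((n : ℝ) + 1)}

/-- The limit sheet has comb codimension one: through `(a, 0)` the vertical line `c ↦ (a, c)`
escapes for every `c ≠ 0`. [folklore] -/
theorem limitSheet_subset_escapable : limitSheet ⊆ escapable univ limitSheet := by
  intro p hp
  have hp2 : p.2 = 0 := hp
  refine ⟨fun c ↦ (p.1, c), ?_, ?_, ?_, ?_, fun _ ↦ mem_univ _, ?_⟩
  · exact contDiff_const.prodMk contDiff_id
  · have h : HasDerivAt (fun c : ℝ ↦ (p.1, c)) ((0 : ℝ), (1 : ℝ)) 0 :=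
      (hasDerivAt_const (0 : ℝ) p.1).prodMk (hasDerivAt_id (0 : ℝ))
    rw [h.deriv]
    simp [Prod.ext_iff]
  · exact Prod.ext rfl hp2.symm
  · intro c₁ c₂ h
    simpa using congrArg Prod.snd h
  · intro c hc hmem
    exact hc hmem

/-- Arithmetic core of the comb: if `|t - 1| < 1/(n+2)` and `t ≠ 1` then `t/(n+1)` is not of the
form `1/(m+1)`, `m ∈ ℕ` (the neighbouring sheets are at distance `≥ 1/((n+1)(n+2))`). [folklore] -/
theorem comb_arith {n m : ℕ} {t : ℝ} (ht : |t - 1| < 1 / ((n : ℝ) + 2)) (ht1 : t ≠ 1)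
    (h : t / ((n : ℝ) + 1) = 1 / ((m : ℝ) + 1)) : False := by
  have hn1 : (0 : ℝ) < (n : ℝ) + 1 := by positivity
  have hn2 : (0 : ℝ) < (n : ℝ) + 2 := by positivity
  have hm1 : (0 : ℝ) < (m : ℝ) + 1 := by positivity
  have hinv : 1 / ((n : ℝ) + 2) * ((n : ℝ) + 2) = 1 := by field_simp
  rw [abs_lt] at ht
  have hlow : (n : ℝ) + 1 < ((n : ℝ) + 2) * t := by nlinarith [ht.1]
  have hup : ((n : ℝ) + 2) * t < (n : ℝ) + 3 := by nlinarith [ht.2]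
  have heq : t * ((m : ℝ) + 1) = (n : ℝ) + 1 := by
    field_simp at h
    linarith
  have htpos : 0 < t := by nlinarith
  rcases lt_trichotomy m n with hmn | hmn | hmn
  · -- `m + 1 ≤ n`: then `t (m + 1) ≤ n t < n + 1`
    have hle : (m : ℝ) + 1 ≤ (n : ℝ) := by exact_mod_cast Nat.succ_le_of_lt hmn
    have h1 : t * ((m : ℝ) + 1) ≤ t * (n : ℝ) := by nlinarith
    nlinarith
  · -- `m = n`: then `t = 1`
    subst hmn
    apply ht1
    have : t * ((m : ℝ) + 1) = 1 * ((m : ℝ) + 1) := by linarith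
    exact mul_right_cancel₀ hm1.ne' this
  · -- `n + 2 ≤ m + 1`: then `t (m + 1) ≥ (n + 2) t > n + 1`
    have hle : (n : ℝ) + 2 ≤ (m : ℝ) + 1 := by
      have : ((n : ℝ) + 1) ≤ (m : ℝ) := by exact_mod_cast Nat.succ_le_of_lt hmn
      linarith
    nlinarith

/-- The comb has comb codimension one: through `(a, b)` with `|b| = 1/(n+1)` the curve
`c ↦ (a, b (1 + arctan c / (2(n+2))))` is smooth, immersed, injective and stays strictly between the
neighbouring sheets for ALL `c`, meeting the comb only at `c = 0`. (A straight vertical line would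
meet the other sheets at parameters `c = ±(1/(m+1) - 1/(n+1)) ≠ 0`: the global-in-`c` clause forces a
bounded reparametrisation.) [folklore] -/
theorem combSheets_subset_escapable : combSheets ⊆ escapable univ combSheets := by
  rintro p ⟨n, hn⟩
  have hn1 : (0 : ℝ) < (n : ℝ) + 1 := by positivity
  have hn2 : (0 : ℝ) < (n : ℝ) + 2 := by positivity
  obtain ⟨δ, hδ⟩ : ∃ δ : ℝ, δ = 1 / (2 * ((n : ℝ) + 2)) := ⟨_, rfl⟩
  have hδpos : 0 < δ := by rw [hδ]; positivity
  have hb : p.2 ≠ 0 := by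
    intro h
    rw [h, abs_zero] at hn
    exact (one_div_pos.mpr hn1).ne' hn.symm
  have hsmall : ∀ c, |δ * Real.arctan c| < 1 / ((n : ℝ) + 2) := by
    intro c
    rw [abs_mul, abs_of_pos hδpos]
    have h1 : |Real.arctan c| < 2 := by
      rw [abs_lt]
      constructor
      · linarith [Real.neg_pi_div_two_lt_arctan c, Real.pi_lt_four]
      · linarith [Real.arctan_lt_pi_div_two c, Real.pi_lt_four]
    calc δ * |Real.arctan c| < δ * 2 := mul_lt_mul_of_pos_left h1 hδpos
      _ = 1 / ((n : ℝ) + 2) := by rw [hδ]; field_simp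
  have hpos : ∀ c, 0 < 1 + δ * Real.arctan c := by
    intro c
    have h2 : 1 / ((n : ℝ) + 2) ≤ 1 / 2 :=
      one_div_le_one_div_of_le (by norm_num) (by linarith [n.cast_nonneg (α := ℝ)])
    have h3 := (abs_lt.mp (lt_of_lt_of_le (hsmall c) h2)).1
    linarith
  refine ⟨fun c ↦ (p.1, p.2 * (1 + δ * Real.arctan c)), ?_, ?_, ?_, ?_, fun _ ↦ mem_univ _, ?_⟩
  · -- smooth
    exact contDiff_const.prodMk
      (contDiff_const.mul (contDiff_const.add (contDiff_const.mul Real.contDiff_arctan)))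
  · -- immersed at `0`
    have h2 : HasDerivAt (fun c : ℝ ↦ p.2 * (1 + δ * Real.arctan c))
        (p.2 * (δ * (1 / (1 + (0 : ℝ) ^ 2)))) 0 :=
      (((Real.hasDerivAt_arctan 0).const_mul δ).const_add 1).const_mul p.2
    have h : HasDerivAt (fun c : ℝ ↦ (p.1, p.2 * (1 + δ * Real.arctan c)))
        ((0 : ℝ), p.2 * (δ * (1 / (1 + (0 : ℝ) ^ 2)))) 0 :=
      (hasDerivAt_const (0 : ℝ) p.1).prodMk h2
    rw [h.deriv]
    simp [Prod.ext_iff, hb, hδpos.ne']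
  · -- base point
    simp
  · -- injective
    intro c₁ c₂ h
    have h2 : p.2 * (1 + δ * Real.arctan c₁) = p.2 * (1 + δ * Real.arctan c₂) :=
      congrArg Prod.snd h
    have h3 : Real.arctan c₁ = Real.arctan c₂ :=
      mul_left_cancel₀ hδpos.ne' (add_left_cancel (mul_left_cancel₀ hb h2))
    exact Real.arctan_strictMono.injective h3
  · -- meets the comb only at `c = 0`
    rintro c hc ⟨m, hm⟩
    have hm' : |p.2 * (1 + δ * Real.arctan c)| = 1 / ((m : ℝ) + 1) := hm
    rw [abs_mul, hn, abs_of_pos (hpos c), one_div_mul_eq_div] at hm'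
    refine comb_arith (n := n) (m := m) (t := 1 + δ * Real.arctan c) ?_ ?_ hm'
    · simpa using hsmall c
    · intro h
      have : δ * Real.arctan c = 0 := by linarith
      rcases mul_eq_zero.mp this with h' | h'
      · exact hδpos.ne' h'
      · apply hc
        rw [← Real.arctan_zero] at h'
        exact Real.arctan_strictMono.injective h'

/-- Through every point of the limit sheet, EVERY continuous curve meets `L ∪ C` again at a non-zero
parameter: either it is back on `L` at `c = 1`, or `|y(1)| > 0` and, by the intermediate value
theorem, `|y|` crosses some sheet `1/(n+1) < |y(1)|` at a parameter `c ∈ (0, 1]`. No smoothness,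
immersion or injectivity requirement can help. [folklore] -/
theorem exists_ne_zero_mem_union_of_continuous {p : ℝ × ℝ} (hp : p ∈ limitSheet)
    {γ : ℝ → ℝ × ℝ} (hγ : Continuous γ) (h0 : γ 0 = p) :
    ∃ c ≠ (0 : ℝ), γ c ∈ limitSheet ∪ combSheets := by
  have hp2 : p.2 = 0 := hp
  by_cases h1 : (γ 1).2 = 0
  · exact ⟨1, one_ne_zero, Or.inl h1⟩
  · have hy : Continuous fun c ↦ |(γ c).2| := continuous_abs.comp (continuous_snd.comp hγ)
    have hy0 : |(γ 0).2| = 0 := by simp [h0, hp2]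
    have hy1 : 0 < |(γ 1).2| := abs_pos.mpr h1
    obtain ⟨n, hn⟩ := exists_nat_one_div_lt hy1
    have hmem : 1 / ((n : ℝ) + 1) ∈ Icc |(γ 0).2| |(γ 1).2| :=
      ⟨by rw [hy0]; positivity, hn.le⟩
    obtain ⟨c, -, hyc⟩ := intermediate_value_Icc zero_le_one hy.continuousOn hmem
    have hyc' : |(γ c).2| = 1 / ((n : ℝ) + 1) := hyc
    refine ⟨c, ?_, Or.inr ⟨n, hyc'⟩⟩
    rintro rfl
    rw [hy0] at hyc'
    have : (0 : ℝ) < 1 / ((n : ℝ) + 1) := by positivity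
    exact this.ne hyc'

/-- The origin is not an escapable point of `L ∪ C`, whatever the admissible class. [folklore] -/
theorem zero_not_mem_escapable_union (𝓓 : Set (ℝ × ℝ)) :
    ((0 : ℝ), (0 : ℝ)) ∉ escapable 𝓓 (limitSheet ∪ combSheets) := by
  rintro ⟨γ, hγ, -, hγ0, -, -, hE⟩
  have h0 : ((0 : ℝ), (0 : ℝ)) ∈ limitSheet := rfl
  obtain ⟨c, hc, hmem⟩ := exists_ne_zero_mem_union_of_continuous h0 hγ.continuous hγ0
  exact hE c hc hmem

/-- `L ∪ C` does NOT have comb codimension one, in any admissible class. [folklore] -/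
theorem not_union_subset_escapable (𝓓 : Set (ℝ × ℝ)) :
    ¬ (limitSheet ∪ combSheets ⊆ escapable 𝓓 (limitSheet ∪ combSheets)) :=
  fun h ↦ zero_not_mem_escapable_union 𝓓 (h (Or.inl (show ((0 : ℝ), (0 : ℝ)) ∈ limitSheet from rfl)))

/-- … although `L ∪ C` is closed (the preimage under `p ↦ |p.2|` of the compact set
`{0} ∪ {1/(n+1) : n ∈ ℕ}`) … [folklore] -/
theorem isClosed_union : IsClosed (limitSheet ∪ combSheets) := by
  have hK : IsClosed (insert (0 : ℝ) (range fun n : ℕ ↦ 1 / ((n : ℝ) + 1))) :=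
    (tendsto_one_div_add_atTop_nhds_zero_nat.isCompact_insert_range).isClosed
  have hset : limitSheet ∪ combSheets =
      (fun p : ℝ × ℝ ↦ |p.2|) ⁻¹' insert (0 : ℝ) (range fun n : ℕ ↦ 1 / ((n : ℝ) + 1)) := by
    ext p
    simp only [limitSheet, combSheets, mem_union, mem_setOf_eq, mem_preimage, mem_insert_iff,
      mem_range, abs_eq_zero]
    constructor
    · rintro (h | ⟨n, hn⟩)
      · exact Or.inl h
      · exact Or.inr ⟨n, hn.symm⟩
    · rintro (h | ⟨n, hn⟩)
      · exact Or.inl h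
      · exact Or.inr ⟨n, hn.symm⟩
  rw [hset]
  exact hK.preimage (continuous_abs.comp continuous_snd)

/-- … and Lebesgue-null (it lies in a countable union of horizontal lines). [folklore] -/
theorem volume_union_eq_zero : volume (limitSheet ∪ combSheets) = 0 := by
  have hline : ∀ t : ℝ, volume {p : ℝ × ℝ | p.2 = t} = 0 := by
    intro t
    have : {p : ℝ × ℝ | p.2 = t} = (univ : Set ℝ) ×ˢ ({t} : Set ℝ) := by
      ext p; simp
    rw [this, Measure.volume_eq_prod, Measure.prod_prod]
    simp
  have hsub : limitSheet ∪ combSheets ⊆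
      {p : ℝ × ℝ | p.2 = 0} ∪ ⋃ n : ℕ, ({p : ℝ × ℝ | p.2 = 1 / ((n : ℝ) + 1)} ∪
        {p : ℝ × ℝ | p.2 = -(1 / ((n : ℝ) + 1))}) := by
    rintro p (h | ⟨n, hn⟩)
    · exact Or.inl h
    · refine Or.inr (mem_iUnion.mpr ⟨n, ?_⟩)
      have hnn : (0 : ℝ) ≤ 1 / ((n : ℝ) + 1) := by positivity
      rcases (abs_eq hnn).mp hn with h' | h'
      · exact Or.inl h'
      · exact Or.inr h'
  refine measure_mono_null hsub (measure_union_null (hline 0) ?_)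
  exact measure_iUnion_null fun n ↦ measure_union_null (hline _) (hline _)

/-- **Comb codimension one is not preserved by unions of exceptional sets** — so tame genericity of
two properties separately does not give tame genericity of their conjunction, whose exceptional set
is the union (compare `exceptional_eq_union`). [folklore] -/
theorem not_forall_union_subset_escapable :
    ¬ ∀ E₁ E₂ : Set (ℝ × ℝ), E₁ ⊆ escapable univ E₁ → E₂ ⊆ escapable univ E₂ →
      E₁ ∪ E₂ ⊆ escapable univ (E₁ ∪ E₂) :=
  fun h ↦ not_union_subset_escapable univ
    (h _ _ limitSheet_subset_escapable combSheets_subset_escapable)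

end Summit.FinalStateConjecture.FinalStateConjecture.Theorems

end
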